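import Summits.NavierStokesRegularity.NavierStokesRegularity.Theorems.SoloRefuteBledsoe2026Fields
import Literature.Barriers.NavierStokesRegularity.ScalingAudit

/-!
# C86 `Bledsoe2026` — kernel countermodel to the cubic stretching bound / discount inequality (3) = (B.4)

B. Bledsoe, *Global Regularity for 3D Navier–Stokes via Coherence Decay* (Zenodo 17116634, 2025), §4.4 p.7
l.2–10: «By Calderón–Zygmund, ‖∇u‖_{L³} ≤ κ₃‖ω‖_{L³} (2) … Naively this yields the critical bound
∫(ω·∇u)·ω|ω| ≲ κ₃‖ω‖³_{L³} … ∫(ω·∇u)·ω|ω| ≤ κ₃‖ω‖³_{L³} − c(K)[ω] (3)» = (B.4) p.20 («explicit discount»,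
`c(K) > 0`, `[ω] ≥ 0`; B.7 p.21: «R_ℓ is dominated by κ₃‖ω‖³_{L³}»; κ₃ = 5, B.8(ii)). By the skeleton's
`cubic_of_discount`, (3)/(B.4) imply the cubic bound `Step_44_cubicStretchingBound`:
`S(u) := ∫⟪Du·ω, ω⟫|ω| ≤ 5‖ω‖³_{L³}` for every smooth compactly supported divergence-free `u`.

**Refutation** (`not_Step_44_cubicStretchingBound`). Under `u ↦ λu` the left side has degree 4
(`stretchInt_const_smul`), the right side degree 3 (`vortL3cubed_const_smul`); the class of test fields is
closed under scalars and `S(−u) = −S(u)`; so the cell's SCALING AUDIT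
(`Literature.Barriers.NavierStokesRegularity.ScalingAudit.not_exists_forall_le_of_amplitude_exponent_ne`)
kills the display for EVERY constant as soon as ONE test field has `S(u) > 0`
(`exists_isTestField_stretchInt_pos`). Witness: the strain cavity `v` and the poloidal ring `w` of the
companion module satisfy the POINTWISE identity `stretchW (v + w) = stretchW v + stretchW w + ‖curl w‖³`
(`stretchW_v_add_w`: inside the unit ball `Dv = diag(1,1,−2)`, `curl v = 0` and `curl w` is horizontal, so
the cavity strain stretches the ring's vorticity at unit rate; outside radius `√(1/2)` the ring vanishes),
hence `S(v + w) = S(v) + S(w) + ‖curl w‖³_{L³}` with `‖curl w‖³_{L³} > 0` (`curl w (e₀/4) = −(5/2)e₁`), and one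
of `v, −v, w, −w, v + w` has `S > 0`. Consequently the discount inequality (3)/(B.4) is false for every
admissible coherence functional (`not_Step_44_discount`), and the line §4.4 → (4) → Thm 2.5 → §5.4 → BKM
has no input. Class (cell vocabulary): false lemma (countermodel) at the concrete twin
`Literature.Claims.NS.Bledsoe2026.Step_44_cubicStretchingBound` of the row's locator `Step_44_naiveHoelder`
(file (A) `SoloRefuteBledsoe2026.lean`). Refuter of record ns-claims-refuter-4 g0.
WHAT THIS IS NOT: not a claim about NS regularity or blow-up; not a claim about any author beyond the
typed locator.
-/

set_option linter.dupNamespace false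

noncomputable section

open Set MeasureTheory Filter Topology
open scoped RealInnerProductSpace ContDiff

namespace Summit.NavierStokesRegularity.NavierStokesRegularity.Theorems.Bledsoe2026

open Literature.Claims.NS.Bledsoe2026 Literature.Analysis.FluidPDE

/-! ## The ring carries vorticity -/

/-- The point `x₀ = (1/4) e₀`, inside the region where `G = id`. -/
def x₀ : E3 := EuclideanSpace.single 0 (1 / 4 : ℝ)

/-- `curl w (x₀) ≠ 0` (its second component is `−5/2`). [folklore] -/
theorem curl_w_x₀_ne_zero : curl w x₀ ≠ 0 := by
  have hs : ‖x₀‖ ^ 2 = 1 / 16 := by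
    rw [EuclideanSpace.norm_eq, Real.sq_sqrt (Finset.sum_nonneg fun i _ => by positivity)]
    simp [x₀]
    norm_num
  have h1 : curl w x₀ 1 = -(5 / 2 : ℝ) := by
    rw [curl_w_apply_one, hs, dG_eq_one (by norm_num), ddG_eq_zero (by norm_num)]
    simp [x₀]
    norm_num
  intro h
  have := congrArg (fun v : E3 => v 1) h
  simp only [h1] at this
  norm_num at this

/-! ## Amplitude scaling and sign change of the weighted stretching and of `‖ω‖³_{L³}` -/

/-- `stretchW (λu) = λ³|λ| · stretchW u` at points of differentiability. [folklore] -/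
theorem stretchW_const_smul {u : E3 → E3} {x : E3} (hu : DifferentiableAt ℝ u x) (l : ℝ) :
    stretchW (fun y => l • u y) x = l ^ 3 * |l| * stretchW u x := by
  unfold stretchW
  rw [fderiv_fun_const_smul hu, curl_const_smul hu]
  simp [real_inner_smul_left, real_inner_smul_right, norm_smul]
  ring

/-- `stretchW (−u) = −stretchW u` (everywhere). [folklore] -/
theorem stretchW_neg (u : E3 → E3) (x : E3) : stretchW (fun y => -u y) x = -stretchW u x := by
  unfold stretchW
  rw [fderiv_fun_neg, curl_neg]
  simp

/-- `S(λu) = λ³|λ| S(u)` for differentiable `u`. [folklore] -/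
theorem stretchInt_const_smul {u : E3 → E3} (hu : Differentiable ℝ u) (l : ℝ) :
    stretchInt (fun y => l • u y) = l ^ 3 * |l| * stretchInt u := by
  unfold stretchInt
  simp_rw [stretchW_const_smul (hu _) l]
  exact integral_const_mul _ _

/-- `S(−u) = −S(u)`. [folklore] -/
theorem stretchInt_neg (u : E3 → E3) : stretchInt (fun y => -u y) = -stretchInt u := by
  unfold stretchInt
  simp_rw [stretchW_neg]
  exact integral_neg _

/-- `‖curl (λu)‖³_{L³} = |λ|³ ‖curl u‖³_{L³}` for differentiable `u`. [folklore] -/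
theorem vortL3cubed_const_smul {u : E3 → E3} (hu : Differentiable ℝ u) (l : ℝ) :
    vortL3cubed (fun y => l • u y) = |l| ^ 3 * vortL3cubed u := by
  unfold vortL3cubed
  simp_rw [curl_const_smul (hu _) l, norm_smul, Real.norm_eq_abs, mul_pow]
  exact integral_const_mul _ _

/-- Test fields are closed under scalar multiples. [folklore] -/
theorem isTestField_const_smul {u : E3 → E3} (hu : IsTestField u) (l : ℝ) :
    IsTestField (fun y => l • u y) := by
  refine ⟨hu.1.const_smul l, hu.2.1.mono fun x hx => ?_, fun x => ?_⟩
  · contrapose! hx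
    simp [Function.notMem_support.1 hx]
  · have hd : DifferentiableAt ℝ u x := (hu.1.differentiable (by simp)) x
    have h0 := hu.2.2 x
    unfold NSWave0.divergence at h0 ⊢
    rw [fderiv_fun_const_smul hd]
    simp [h0]

/-- Test fields are closed under negation. [folklore] -/
theorem isTestField_neg {u : E3 → E3} (hu : IsTestField u) : IsTestField (fun y => -u y) := by
  simpa using isTestField_const_smul hu (-1)

/-- Test fields are closed under sums. [folklore] -/
theorem isTestField_add {u u' : E3 → E3} (hu : IsTestField u) (hu' : IsTestField u') :
    IsTestField (fun y => u y + u' y) := by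
  refine ⟨hu.1.add hu'.1, hu.2.1.add hu'.2.1, fun x => ?_⟩
  have hd : DifferentiableAt ℝ u x := (hu.1.differentiable (by simp)) x
  have hd' : DifferentiableAt ℝ u' x := (hu'.1.differentiable (by simp)) x
  have h0 := hu.2.2 x
  have h0' := hu'.2.2 x
  unfold NSWave0.divergence at h0 h0' ⊢
  rw [fderiv_fun_add hd hd']
  simp [h0, h0']

/-- The weighted stretching density of a smooth field is continuous. [folklore] -/
theorem continuous_stretchW {u : E3 → E3} (hu : ContDiff ℝ ∞ u) : Continuous (stretchW u) := by
  have h1 : Continuous (fderiv ℝ u) := hu.continuous_fderiv (by simp)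
  have h2 : Continuous (curl u) := continuous_curl (hu.of_le (by exact_mod_cast le_top))
  exact ((h1.clm_apply h2).inner h2).mul h2.norm

/-- The weighted stretching density vanishes off the support of the field. [folklore] -/
theorem hasCompactSupport_stretchW {u : E3 → E3} (hu : HasCompactSupport u) :
    HasCompactSupport (stretchW u) :=
  HasCompactSupport.intro hu fun x hx => by simp [stretchW, curl_eq_zero_of_notMem_tsupport hx]

/-- `‖curl u‖³` is continuous for smooth `u`. [folklore] -/
theorem continuous_norm_curl_cube {u : E3 → E3} (hu : ContDiff ℝ ∞ u) :
    Continuous fun x => ‖curl u x‖ ^ 3 :=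
  (continuous_curl (hu.of_le (by exact_mod_cast le_top))).norm.pow 3

/-- `‖curl u‖³` vanishes off the support of `u`. [folklore] -/
theorem hasCompactSupport_norm_curl_cube {u : E3 → E3} (hu : HasCompactSupport u) :
    HasCompactSupport fun x => ‖curl u x‖ ^ 3 :=
  HasCompactSupport.intro hu fun x hx => by simp [curl_eq_zero_of_notMem_tsupport hx]

/-! ## The two-bump field `v + w`: the cavity strain stretches the ring's vorticity pointwise -/

/-- **Pointwise identity**: `stretchW (v + w) = stretchW v + stretchW w + ‖curl w‖³`. Inside the unit ball
`Dv = D`, `curl v = 0` and `curl w` is horizontal, so the cross term is `⟪D ω_w, ω_w⟫‖ω_w‖ = ‖ω_w‖³`;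
outside radius `√(1/2)` the ring `w` vanishes identically. [folklore] -/
theorem stretchW_v_add_w (x : E3) :
    stretchW (fun y => v y + w y) x = stretchW v x + stretchW w x + ‖curl w x‖ ^ 3 := by
  have hv := v_differentiable x
  have hw := w_differentiable x
  unfold stretchW
  rw [fderiv_fun_add hv hw, curl_add hv hw]
  rcases lt_or_ge (‖x‖ ^ 2) 1 with h1 | h1
  · have hx : ‖x‖ < 1 := by nlinarith [norm_nonneg x]
    rw [fderiv_v hx, curl_v hx, zero_add]
    simp [inner_add_left, inner_Dlin_of_horizontal (curl_w_apply_two x)]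
    ring
  · have hx : 1 / 2 < ‖x‖ ^ 2 := by linarith
    rw [fderiv_w_eq_zero hx, curl_w_eq_zero hx]
    simp

/-- `S(v + w) = S(v) + S(w) + ‖curl w‖³_{L³}`. [folklore] -/
theorem stretchInt_v_add_w :
    stretchInt (fun y => v y + w y) = stretchInt v + stretchInt w + vortL3cubed w := by
  unfold stretchInt vortL3cubed
  simp_rw [stretchW_v_add_w]
  have iv : Integrable (stretchW v) := (continuous_stretchW v_contDiff).integrable_of_hasCompactSupport
    (hasCompactSupport_stretchW v_hasCompactSupport)
  have iw : Integrable (stretchW w) := (continuous_stretchW w_contDiff).integrable_of_hasCompactSupport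
    (hasCompactSupport_stretchW w_hasCompactSupport)
  have ic : Integrable (fun x => ‖curl w x‖ ^ 3) :=
    (continuous_norm_curl_cube w_contDiff).integrable_of_hasCompactSupport
      (hasCompactSupport_norm_curl_cube w_hasCompactSupport)
  have ivw : Integrable (fun x => stretchW v x + stretchW w x) := iv.add iw
  rw [integral_add ivw ic, integral_add iv iw]

/-- `‖curl w‖³_{L³} > 0`: the ring carries vorticity (`curl w (x₀) ≠ 0`). [folklore] -/
theorem vortL3cubed_w_pos : 0 < vortL3cubed w :=
  (continuous_norm_curl_cube w_contDiff).integral_pos_of_hasCompactSupport_nonneg_nonzero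
    (hasCompactSupport_norm_curl_cube w_hasCompactSupport) (fun x => by positivity)
    (pow_ne_zero 3 (norm_ne_zero_iff.2 curl_w_x₀_ne_zero))

/-- `v` is a test field. [folklore] -/
theorem v_isTestField : IsTestField v := ⟨v_contDiff, v_hasCompactSupport, divergence_v⟩

/-- `w` is a test field. [folklore] -/
theorem w_isTestField : IsTestField w := ⟨w_contDiff, w_hasCompactSupport, divergence_w⟩

/-- **A test field with positive weighted stretching exists** (one of `v, −v, w, −w, v + w`: if
`S(v) = S(w) = 0` then `S(v + w) = ‖curl w‖³_{L³} > 0`). [folklore] -/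
theorem exists_isTestField_stretchInt_pos : ∃ u, IsTestField u ∧ 0 < stretchInt u := by
  rcases lt_trichotomy 0 (stretchInt v) with hv | hv | hv
  · exact ⟨v, v_isTestField, hv⟩
  · rcases lt_trichotomy 0 (stretchInt w) with hw | hw | hw
    · exact ⟨w, w_isTestField, hw⟩
    · refine ⟨fun y => v y + w y, isTestField_add v_isTestField w_isTestField, ?_⟩
      rw [stretchInt_v_add_w, ← hv, ← hw, zero_add, zero_add]
      exact vortL3cubed_w_pos
    · exact ⟨fun y => -w y, isTestField_neg w_isTestField, by rw [stretchInt_neg]; linarith⟩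
  · exact ⟨fun y => -v y, isTestField_neg v_isTestField, by rw [stretchInt_neg]; linarith⟩

/-- **Kill (concrete twin)**: the cubic stretching bound `∫(ω·∇u)·ω|ω| ≤ κ₃‖ω‖³_{L³}` (κ₃ = 5) — the
necessary consequence `cubic_of_discount` of the discount inequality (3) p.7 / (B.4) p.20 — is false on
smooth compactly supported divergence-free fields: the left side has amplitude degree 4, the right side
degree 3 (cell tool `ScalingAudit.not_exists_forall_le_of_amplitude_exponent_ne`), and a test field with
positive weighted stretching exists (`exists_isTestField_stretchInt_pos`).
[cite: Bledsoe2026, §4.4 (2)–(3) p.7; (B.4) p.20; B.7 p.21] -/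
theorem not_Step_44_cubicStretchingBound : ¬ Step_44_cubicStretchingBound := by
  intro h
  obtain ⟨u₀, hu₀, hpos⟩ := exists_isTestField_stretchInt_pos
  have hS : ∀ l : ℝ, 0 < l → ∀ u ∈ {u : E3 → E3 | IsTestField u},
      l • u ∈ {u : E3 → E3 | IsTestField u} :=
    fun l _ u hu => isTestField_const_smul hu l
  have hF : ∀ l : ℝ, 0 < l → ∀ u ∈ {u : E3 → E3 | IsTestField u},
      stretchInt (l • u) = l ^ (4 : ℝ) * stretchInt u := by
    intro l hl u hu
    rw [show l • u = fun y => l • u y from rfl,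
      stretchInt_const_smul (hu.1.differentiable (by simp)) l, abs_of_pos hl,
      show (4 : ℝ) = ((4 : ℕ) : ℝ) by norm_num, Real.rpow_natCast]
    ring
  have hG : ∀ l : ℝ, 0 < l → ∀ u ∈ {u : E3 → E3 | IsTestField u},
      vortL3cubed (l • u) = l ^ (3 : ℝ) * vortL3cubed u := by
    intro l hl u hu
    rw [show l • u = fun y => l • u y from rfl,
      vortL3cubed_const_smul (hu.1.differentiable (by simp)) l, abs_of_pos hl,
      show (3 : ℝ) = ((3 : ℕ) : ℝ) by norm_num, Real.rpow_natCast]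
  exact Literature.Barriers.NavierStokesRegularity.ScalingAudit.not_exists_forall_le_of_amplitude_exponent_ne
    hS hF hG (by norm_num) hu₀ hpos ⟨5, fun u hu => h u hu⟩

/-- **Kill of the discount inequality (3)/(B.4) for EVERY admissible coherence functional**: no `Coh ≥ 0`
and `c_K ≥ 0` make `∫(ω·∇u)·ω|ω| ≤ κ₃‖ω‖³_{L³} − c_K·Coh[ω]` true on test fields (via the skeleton's
`cubic_of_discount`). [cite: Bledsoe2026, §4.4 (3) p.7; (B.4) p.20] -/
theorem not_Step_44_discount (Coh : (E3 → E3) → ℝ) {cK : ℝ} (hc : 0 ≤ cK) (hCoh : ∀ b, 0 ≤ Coh b) :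
    ¬ Step_44_discount Coh cK := fun hd =>
  not_Step_44_cubicStretchingBound (cubic_of_discount hc hCoh hd)

end Summit.NavierStokesRegularity.NavierStokesRegularity.Theorems.Bledsoe2026

end
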